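import Summits.CriticalPhenomena.PercolationContinuityZ3.Theorems.PercNearOneGluingNoHeavyLowerTailSahiE3JuntaMeetSmall
import Summits.CriticalPhenomena.PercolationContinuityZ3.Theorems.PercNearOneGluingNoHeavyLowerTailSahiE3PrincipalMeetKahnForm
import Mathlib.Tactic.Linarith
import Mathlib.Tactic.Ring
import HarnessLib

/-!
# `NoHeavyLowerTail` (crux stmt-CriticalPhenomena-4575), Sahi programme P4: "Sahi's inequality is local in the intersection" in the
# language of Kahn's Conjecture 5 (`sahiE3 (prodBernoulli p)`, `DeterminedBy`)

Support file (cell `prim-l12`, seat P4, generation 3; `--supports stmt-CriticalPhenomena-4575`).  No named facts, no sorries, no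
definitions.  Transports the locality theorem `SahiE3JuntaMeet.sahiE3_nonneg_of_mul_junta_of_block` (`…SahiE3JuntaMeetBlock`) and its
unconditional `≤ 3`-coordinate instance (`…SahiE3JuntaMeetSmall`) into the statement language of the tree's
`KahnConjecture : ∀ ι [Fintype ι] p (A B C : Set (Set ι)), IsUpperSet A → IsUpperSet B → IsUpperSet C → 0 ≤ sahiE3 (prodBernoulli p) A B C`,
the block being a set of coordinates `W : Finset ι` and "`A ∩ B` depends only on `W`" being the tree's `DeterminedBy (A ∩ B) ↑W`
(`Literature.Probability.Percolation.PercolationEvents`).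

* **`kahn_of_inter_determinedBy`** — LOCALITY: for a finite index type `ι`, `W : Finset ι`, `p : ι → [0,1]`, increasing
  `U, A, B ⊆ Set ι` with `DeterminedBy (A ∩ B) ↑W`: if Kahn's Conjecture 5 holds on the index type `↥W` (all weights, all increasing
  triples of `Set ↥W`), then `0 ≤ sahiE3 (prodBernoulli p) U A B`.  Hence Kahn's conjecture for index types of cardinality `≤ m` implies
  it, on EVERY finite index type, for all triples one of whose pairwise intersections is determined by `≤ m` coordinates; and a minimal
  counterexample has all three pairwise intersections determined by no proper subset of the coordinates.
* **`kahn_of_inter_determinedBy_card_le_three`** — UNCONDITIONAL: the same conclusion when `W.card ≤ 3` (kernel-checked cube theorem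
  `SahiC3Cube.sahiC3_of_card_le_three` of the Sahi cell; axioms `propext`, `Classical.choice`, `Quot.sound`).  [this work]
-/

noncomputable section

open Classical

namespace Summit.CriticalPhenomena.PercolationContinuityZ3.Theorems

namespace SahiE3JuntaMeet

open Finset MeasureTheory Literature.Probability.Percolation Literature.Probability.Percolation.DecisionTree
  Literature.Probability.LatticeModels SahiE3PrincipalMeet

variable {ι : Type*} [Fintype ι] [DecidableEq ι]

omit [Fintype ι] [DecidableEq ι] in
/-- Indicators are `{0,1}`-valued. [folklore] -/
theorem indicator_one_zero_or_one (X : Set (Set ι)) (S : Finset ι) :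
    X.indicator (1 : Set ι → ℝ) (↑S : Set ι) = 0 ∨ X.indicator (1 : Set ι → ℝ) (↑S : Set ι) = 1 := by
  by_cases h : (↑S : Set ι) ∈ X
  · exact Or.inr (by rw [Set.indicator_of_mem h, Pi.one_apply])
  · exact Or.inl (Set.indicator_of_notMem h _)

/-- If `A ∩ B` is determined by the coordinates `W`, the product of the indicators of `A` and `B` does not see the other coordinates:
for `Z ⊆ univ ∖ W`, `T ⊆ W`, `(𝟙_A 𝟙_B)(Z ∪ T) = (𝟙_A 𝟙_B)((univ ∖ W) ∪ T)`. [folklore] -/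
theorem indicator_mul_junta_of_determinedBy (W : Finset ι) {A B : Set (Set ι)} (hAB : DeterminedBy (A ∩ B) (↑W : Set ι))
    (Z : Finset ι) (hZ : Z ⊆ Finset.univ \ W) (T : Finset ι) (hT : T ⊆ W) :
    A.indicator (1 : Set ι → ℝ) (↑(Z ∪ T) : Set ι) * B.indicator 1 (↑(Z ∪ T) : Set ι)
      = A.indicator (1 : Set ι → ℝ) (↑((Finset.univ \ W) ∪ T) : Set ι) * B.indicator 1 (↑((Finset.univ \ W) ∪ T) : Set ι) := by
  rw [← indicator_inter_apply_eq_mul, ← indicator_inter_apply_eq_mul]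
  have key : ∀ Y : Finset ι, Y ⊆ Finset.univ \ W → (↑(Y ∪ T) : Set ι) ∩ ↑W = (↑T : Set ι) := by
    intro Y hY
    ext i
    simp only [Set.mem_inter_iff, Finset.mem_coe, Finset.mem_union]
    constructor
    · rintro ⟨hi | hi, hiW⟩
      · exact absurd hiW (Finset.mem_sdiff.1 (hY hi)).2
      · exact hi
    · intro hi
      exact ⟨Or.inr hi, hT hi⟩
  have hiff : (↑(Z ∪ T) : Set ι) ∈ A ∩ B ↔ (↑((Finset.univ \ W) ∪ T) : Set ι) ∈ A ∩ B :=
    (determinedBy_iff _ _).1 hAB _ _ (by rw [key Z hZ, key _ (Finset.Subset.refl _)])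
  by_cases h : (↑(Z ∪ T) : Set ι) ∈ A ∩ B
  · rw [Set.indicator_of_mem h, Set.indicator_of_mem (hiff.1 h), Pi.one_apply, Pi.one_apply]
  · rw [Set.indicator_of_notMem h, Set.indicator_of_notMem (fun h' => h (hiff.2 h'))]

/-- **Locality of Kahn's Conjecture 5 in the intersection.**  Let `ι` be a finite index type, `W : Finset ι`, `p : ι → [0,1]`, and
`U, A, B ⊆ Set ι` increasing with `A ∩ B` determined by the coordinates `W`.  If Sahi's inequality holds on the index type `↥W` —
`0 ≤ sahiE3 (prodBernoulli q) T A' B'` for every `q : ↥W → [0,1]` and all increasing `T, A', B' ⊆ Set ↥W` — then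
`0 ≤ sahiE3 (prodBernoulli p) U A B`.  [this work; `sahiE3_nonneg_of_mul_junta_of_block` + the two `ED`/`prodBernoulli` bridges] -/
theorem kahn_of_inter_determinedBy (p : ι → unitInterval) (W : Finset ι) {U A B : Set (Set ι)} (hU : IsUpperSet U)
    (hA : IsUpperSet A) (hB : IsUpperSet B) (hAB : DeterminedBy (A ∩ B) (↑W : Set ι))
    (hK : ∀ (q : ↥W → unitInterval) (T A' B' : Set (Set ↥W)), IsUpperSet T → IsUpperSet A' → IsUpperSet B' →
      0 ≤ sahiE3 (prodBernoulli q) T A' B') :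
    0 ≤ sahiE3 (prodBernoulli p) U A B := by
  rw [sahiE3_prodBernoulli_eq_ED]
  have huniv : W ∪ (Finset.univ \ W) = (Finset.univ : Finset ι) := Finset.union_sdiff_of_subset (Finset.subset_univ W)
  rw [← huniv]
  have hp0 : ∀ i, 0 ≤ ((p i : unitInterval) : ℝ) := fun i => (p i).2.1
  have hp1 : ∀ i, ((p i : unitInterval) : ℝ) ≤ 1 := fun i => (p i).2.2
  refine sahiE3_nonneg_of_mul_junta_of_block W (Finset.univ \ W) Finset.disjoint_sdiff hp0 hp1
    (indicator_mono_of_isUpperSet hU) (indicator_one_zero_or_one U) (indicator_mono_of_isUpperSet hA)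
    (indicator_one_zero_or_one A) (indicator_mono_of_isUpperSet hB) (indicator_one_zero_or_one B)
    (fun Z hZ T hT => indicator_mul_junta_of_determinedBy W hAB Z hZ T hT) ?_
  intro t ht ht01
  -- the block hypothesis: read the `ED`-form on `W` as `sahiE3` of block events under `prodBernoulli` on `↥W`
  have hfs : ∀ ⦃S T : Finset ι⦄, S ⊆ T →
      A.indicator (1 : Set ι → ℝ) (↑((Finset.univ \ W) ∪ S) : Set ι) ≤ A.indicator 1 (↑((Finset.univ \ W) ∪ T) : Set ι) :=
    fun S T hST => indicator_mono_of_isUpperSet hA (Finset.union_subset_union (Finset.Subset.refl _) hST)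
  have hgs : ∀ ⦃S T : Finset ι⦄, S ⊆ T →
      B.indicator (1 : Set ι → ℝ) (↑((Finset.univ \ W) ∪ S) : Set ι) ≤ B.indicator 1 (↑((Finset.univ \ W) ∪ T) : Set ι) :=
    fun S T hST => indicator_mono_of_isUpperSet hB (Finset.union_subset_union (Finset.Subset.refl _) hST)
  rw [ED_sahiE3_eq W hp0 hp1 ht01 (fun S => indicator_one_zero_or_one A _) (fun S => indicator_one_zero_or_one B _)]
  have hq : (fun i : ↥W => (⟨((p i : unitInterval) : ℝ), hp0 i, hp1 i⟩ : unitInterval)) = fun i : ↥W => p i := by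
    funext i; rfl
  rw [hq]
  exact hK _ _ _ _ (isUpperSet_blockEvent W ht ht01) (isUpperSet_blockEvent W hfs fun S => indicator_one_zero_or_one A _)
    (isUpperSet_blockEvent W hgs fun S => indicator_one_zero_or_one B _)

/-- **Kahn's Conjecture 5 holds whenever `A ∩ B` is determined by at most three coordinates — unconditionally, on every finite index
type.**  For `W : Finset ι` with `W.card ≤ 3`, `p : ι → [0,1]`, increasing `U, A, B ⊆ Set ι` with `DeterminedBy (A ∩ B) ↑W`:
`0 ≤ sahiE3 (prodBernoulli p) U A B`.  [this work; `kahn_of_inter_determinedBy` + `SahiC3Cube.sahiC3_of_card_le_three`] -/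
theorem kahn_of_inter_determinedBy_card_le_three (p : ι → unitInterval) (W : Finset ι) (hW : W.card ≤ 3) {U A B : Set (Set ι)}
    (hU : IsUpperSet U) (hA : IsUpperSet A) (hB : IsUpperSet B) (hAB : DeterminedBy (A ∩ B) (↑W : Set ι)) :
    0 ≤ sahiE3 (prodBernoulli p) U A B := by
  have hcard : Fintype.card ↥W ≤ 3 := by rw [Fintype.card_coe]; exact hW
  exact kahn_of_inter_determinedBy p W hU hA hB hAB fun q T A' B' hT hA' hB' =>
    SahiC3Cube.sahiC3_of_card_le_three hcard q hT hA' hB'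

end SahiE3JuntaMeet

end Summit.CriticalPhenomena.PercolationContinuityZ3.Theorems

end
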